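import Summits.AtomisticToContinuum.Crystallization.Theorems.FreeSplittingCertificatesStrictSplittingRuleP1CubeRec
import Summits.AtomisticToContinuum.Crystallization.Theorems.FreeSplittingCertificatesStrictSplittingRuleP1CellDiam

/-!
# `StrictSplittingRule` (stmt-AtomisticToContinuum-12560): the RECEIPTS TRANSFER — `a⁴·∫ w·fpRec(∇v) ≤ Σ'_cubes p1CubeRec W` for the P1 interpolant of any finitely supported displacement (P1 interpolant object, part 15)

Route `FreeSplittingCertificates`, crux r3 `StrictSplittingRule` (H12⋆ = `stub_coreJointCoercive`), unit b2b-freesplit-B gen 22.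
VALUE = item (2'') of HOME FAR-LEMMA-SPEC §16 (c), RECEIPTS SIDE, as a tree theorem (the matched-weight design of §7 (k): the continuum
receipts of the far pencil are dominated by a lattice quadratic form in first-shell STRETCHES with explicit, cube-local weights):
for the far-ledger field `v = p1Disp a h U b₀ A` of a finitely supported lattice displacement `U` (minus any affine field), every
nonnegative integrable weight `w` on `ℝ³`, on the hcp ratio box `81619/100000·a ≤ h ≤ 81657/100000·a`,
* `exists_lipschitzWith_p1Disp` — `v` is Lipschitz (cellwise-affine structure of gen 20 + `lipschitzWith_of_locallyAffine_off_faces`);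
* `abs_p1Str_le`, `sq_p1Str_corner_le` — uniform bounds of the lattice stretches of `v` along cube edges;
* `p1CubeRec_le_sum_weights` — `p1CubeRec W n ≤ C·Σ_π W(n,π)`, hence `summable_p1CubeRec` for the cell weights `W_i = ∫_{cell i} w`;
* **`integral_fpRec_le_tsum_p1CubeRec`** — `a⁴·∫ w(x)·fpRec(∇v(x)) dx ≤ Σ'_n p1CubeRec W n`
  (cells decomposition `hasSum_integral_iUnion_ae` + cellwise constant gradients + the per-cube inequality `p1Cube_receipts`);
* **`integral_chiSq_fpDen_translate_le_tsum`** — the form the assembly consumes: for a `C²` weight `χ` vanishing near `0` and `= 1`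
  outside a ball (e.g. the ledger's split weight `fpChi R₁² R₂²`) and ANY base point `y₀`,
  `a⁴·∫ χ(x)²·Den(x, ∇ṽ(x)) dx ≤ Σ'_n p1CubeRec W n` for the RE-BASED field `ṽ(x) = v(y₀ + x)` of
  `farPencil4_weighted_integral_le_p1Disp_translate`, with `W_i = ∫_{cell i} χ(y − y₀)²·|y − y₀|⁻⁶ dy` — i.e. the receipts integral
  on the right of the far inequality at site `p` (`y₀ = y_p`) is paid by lattice stretches around `p` with weights = sharp element
  constants × smeared `χ²r⁻⁶` cell integrals.  What remains of the transfer: regroup `Σ_n p1CubeRec` bond by bond into table weights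
  (finite combinatorics of the slot tables) and the readout/bare UPWARD comparisons (demand side).
NOT a proof of H12⋆, NOT summit progress.  [folklore]
-/

noncomputable section

open Set Function Metric MeasureTheory Filter Topology
open scoped BigOperators NNReal ENNReal

namespace Summit.AtomisticToContinuum.Crystallization.Theorems.StrictSplittingRuleBirth

open Literature.MathematicalPhysics.StatisticalMechanics
open Summit.AtomisticToContinuum.Crystallization.Theorems.PalmUnimodularRigidity.LayeredLawsSelectHcp
open Summit.AtomisticToContinuum.Crystallization.Theorems.PhononStabilityCWC.Cert (inner_fin3)

/-! ## The far-ledger field is Lipschitz; uniform stretch bounds -/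

/-- **The far-ledger field of a finitely supported displacement is Lipschitz** (sup norms), with the constant
`sup_i ‖cell slope‖ + ‖A‖` of the cellwise-affine structure. -/
theorem exists_lipschitzWith_p1Disp {a h : ℝ} (ha : a ≠ 0) (hh : h ≠ 0) (U : ℤ × ℤ × ℤ → (Fin 3 → ℝ)) (hU : (support U).Finite)
    (b₀ : Fin 3 → ℝ) (A : Fin 3 → Fin 3 → ℝ) : ∃ K : ℝ≥0, LipschitzWith K (p1Disp a h U b₀ A) := by
  obtain ⟨K, hK⟩ := exists_bound_p1CellMap a h U hU
  refine ⟨K + ‖p1AffCLM A‖₊, ?_⟩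
  have haff : ∀ i, ∃ (c : Fin 3 → ℝ) (L : (Fin 3 → ℝ) →L[ℝ] (Fin 3 → ℝ)), ‖L‖ ≤ ((K + ‖p1AffCLM A‖₊ : ℝ≥0) : ℝ) ∧
      ∀ y ∈ p1RealCell a h i, p1Disp a h U b₀ A y = c + L y := fun i =>
    ⟨p1CellConst a h U i - b₀, p1CellMap a h U i - p1AffCLM A, norm_p1CellMap_sub_le hK A i,
      fun y hy => p1Disp_eq_affine U b₀ A hy⟩
  exact lipschitzWith_of_locallyAffine_off_faces (p1Face_subset_plane a h) (p1FacetPlane_ne_top ha hh) (p1Face_locallyFinite a h)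
    (continuous_p1Disp a h U b₀ A) (locallyAffine_norm_of_cellwise_affine (exists_p1RealCell a h) haff (frontier_p1RealCell_subset a h))

/-- **Uniform stretch bound**: for a `K`-Lipschitz far-ledger field, `|str(q,q′)| ≤ 3·K·‖y_{q′} − y_q‖²` (sup norm of the bond vector). -/
theorem abs_p1Str_le {a h : ℝ} {U : ℤ × ℤ × ℤ → (Fin 3 → ℝ)} {b₀ : Fin 3 → ℝ} {A : Fin 3 → Fin 3 → ℝ} {K : ℝ≥0}
    (hK : LipschitzWith K (p1Disp a h U b₀ A)) (q q' : ℤ × ℤ × ℤ) :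
    |p1Str a h U b₀ A q q'| ≤
      3 * K * ‖(fun k => hcpSite a h q' k) - (fun k => hcpSite a h q k)‖ ^ 2 := by
  set δ : Fin 3 → ℝ := (fun k => hcpSite a h q' k) - (fun k => hcpSite a h q k) with hδ
  have hd : ∀ k, |hcpSite a h q' k - hcpSite a h q k| ≤ ‖δ‖ := fun k => by
    have : |δ k| ≤ ‖δ‖ := by rw [← Real.norm_eq_abs]; exact norm_le_pi_norm δ k
    simpa [hδ] using this
  have he : ∀ k, |p1Disp a h U b₀ A (fun j => hcpSite a h q' j) k - p1Disp a h U b₀ A (fun j => hcpSite a h q j) k| ≤ K * ‖δ‖ :=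
    fun k => by
    have h1 : |(p1Disp a h U b₀ A (fun j => hcpSite a h q' j) - p1Disp a h U b₀ A (fun j => hcpSite a h q j)) k| ≤
        ‖p1Disp a h U b₀ A (fun j => hcpSite a h q' j) - p1Disp a h U b₀ A (fun j => hcpSite a h q j)‖ := by
      rw [← Real.norm_eq_abs]; exact norm_le_pi_norm _ k
    have h2 : ‖p1Disp a h U b₀ A (fun j => hcpSite a h q' j) - p1Disp a h U b₀ A (fun j => hcpSite a h q j)‖ ≤ K * ‖δ‖ := by
      rw [hδ, ← dist_eq_norm, ← dist_eq_norm]; exact hK.dist_le_mul _ _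
    rw [Pi.sub_apply] at h1
    exact h1.trans h2
  have hδ0 : 0 ≤ ‖δ‖ := norm_nonneg _
  have hK0 : (0 : ℝ) ≤ K := K.2
  unfold p1Str
  rw [inner_fin3]
  simp only [PiLp.sub_apply, p1DispSite]
  have m0 := mul_le_mul (hd 0) (he 0) (abs_nonneg _) hδ0
  have m1 := mul_le_mul (hd 1) (he 1) (abs_nonneg _) hδ0
  have m2 := mul_le_mul (hd 2) (he 2) (abs_nonneg _) hδ0
  rw [← abs_mul] at m0 m1 m2
  calc |_| ≤ |(hcpSite a h q' 0 - hcpSite a h q 0) *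
          (p1Disp a h U b₀ A (fun j => hcpSite a h q' j) 0 - p1Disp a h U b₀ A (fun j => hcpSite a h q j) 0)| +
        |(hcpSite a h q' 1 - hcpSite a h q 1) *
          (p1Disp a h U b₀ A (fun j => hcpSite a h q' j) 1 - p1Disp a h U b₀ A (fun j => hcpSite a h q j) 1)| +
        |(hcpSite a h q' 2 - hcpSite a h q 2) *
          (p1Disp a h U b₀ A (fun j => hcpSite a h q' j) 2 - p1Disp a h U b₀ A (fun j => hcpSite a h q j) 2)| :=
        abs_add_three _ _ _
    _ ≤ ‖δ‖ * (K * ‖δ‖) + ‖δ‖ * (K * ‖δ‖) + ‖δ‖ * (K * ‖δ‖) := by linarith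
    _ = 3 * K * ‖δ‖ ^ 2 := by ring

/-- Cube corners are within `2|a| + |h|` of the cube-origin site, componentwise. -/
theorem abs_hcpSite_corner_sub_le (a h : ℝ) (n o : ℤ × ℤ × ℤ)
    (ho : (o.1 = 0 ∨ o.1 = 1) ∧ (o.2.1 = 0 ∨ o.2.1 = 1) ∧ (o.2.2 = 0 ∨ o.2.2 = 1)) (j : Fin 3) :
    |hcpSite a h (n + o) j - hcpSite a h n j| ≤ 2 * |a| + |h| := by
  rw [← p1Chart_p1Vec a h _ j, ← p1Chart_p1Vec a h n j]
  refine abs_p1Chart_sub_le a h (fun k => ?_) j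
  rw [p1Vec_add, Pi.add_apply]
  fin_cases k
  · rcases ho.1 with h0 | h0 <;> simp [h0]
  · rcases ho.2.1 with h0 | h0 <;> simp [h0]
  · rcases ho.2.2 with h0 | h0 <;> simp [h0]

/-- **Stretch bound along a cube edge**: for corners `o, o′` of cube `n`, `str(n+o, n+o′)² ≤ (3·K·(2(2|a|+|h|))²)²`. -/
theorem sq_p1Str_corner_le {a h : ℝ} {U : ℤ × ℤ × ℤ → (Fin 3 → ℝ)} {b₀ : Fin 3 → ℝ} {A : Fin 3 → Fin 3 → ℝ} {K : ℝ≥0}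
    (hK : LipschitzWith K (p1Disp a h U b₀ A)) (n o o' : ℤ × ℤ × ℤ)
    (ho : (o.1 = 0 ∨ o.1 = 1) ∧ (o.2.1 = 0 ∨ o.2.1 = 1) ∧ (o.2.2 = 0 ∨ o.2.2 = 1))
    (ho' : (o'.1 = 0 ∨ o'.1 = 1) ∧ (o'.2.1 = 0 ∨ o'.2.1 = 1) ∧ (o'.2.2 = 0 ∨ o'.2.2 = 1)) :
    p1Str a h U b₀ A (n + o) (n + o') ^ 2 ≤ (3 * K * (2 * (2 * |a| + |h|)) ^ 2) ^ 2 := by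
  have hD : ‖(fun k => hcpSite a h (n + o') k) - (fun k => hcpSite a h (n + o) k)‖ ≤ 2 * (2 * |a| + |h|) := by
    refine (pi_norm_le_iff_of_nonneg (by positivity)).2 fun k => ?_
    rw [Pi.sub_apply, Real.norm_eq_abs]
    have h1 := abs_hcpSite_corner_sub_le a h n o ho k
    have h2 := abs_hcpSite_corner_sub_le a h n o' ho' k
    rw [abs_le] at h1 h2 ⊢
    constructor <;> linarith [h1.1, h1.2, h2.1, h2.2]
  have hB := abs_p1Str_le hK (n + o) (n + o')
  have hK0 : (0 : ℝ) ≤ K := K.2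
  have hB' : |p1Str a h U b₀ A (n + o) (n + o')| ≤ 3 * K * (2 * (2 * |a| + |h|)) ^ 2 :=
    hB.trans (by gcongr)
  have h0 : 0 ≤ 3 * K * (2 * (2 * |a| + |h|)) ^ 2 := by positivity
  calc p1Str a h U b₀ A (n + o) (n + o') ^ 2 = |p1Str a h U b₀ A (n + o) (n + o')| ^ 2 := (sq_abs _).symm
    _ ≤ (3 * K * (2 * (2 * |a| + |h|)) ^ 2) ^ 2 := pow_le_pow_left₀ (abs_nonneg _) hB' 2

/-- The slot tables list cube corners (entries in `{0,1}`). -/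
theorem p1TetTail_corner (b : Bool) (p : Fin 2) (e : Fin 6) :
    ((p1TetTail b p e).1 = 0 ∨ (p1TetTail b p e).1 = 1) ∧ ((p1TetTail b p e).2.1 = 0 ∨ (p1TetTail b p e).2.1 = 1) ∧
      ((p1TetTail b p e).2.2 = 0 ∨ (p1TetTail b p e).2.2 = 1) := by
  revert b p e; decide

/-- The slot tables list cube corners (entries in `{0,1}`). -/
theorem p1TetHead_corner (b : Bool) (p : Fin 2) (e : Fin 6) :
    ((p1TetHead b p e).1 = 0 ∨ (p1TetHead b p e).1 = 1) ∧ ((p1TetHead b p e).2.1 = 0 ∨ (p1TetHead b p e).2.1 = 1) ∧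
      ((p1TetHead b p e).2.2 = 0 ∨ (p1TetHead b p e).2.2 = 1) := by
  revert b p e; decide

/-- The slot tables list cube corners (entries in `{0,1}`). -/
theorem p1OctTail_corner (b : Bool) (e : Fin 12) :
    ((p1OctTail b e).1 = 0 ∨ (p1OctTail b e).1 = 1) ∧ ((p1OctTail b e).2.1 = 0 ∨ (p1OctTail b e).2.1 = 1) ∧
      ((p1OctTail b e).2.2 = 0 ∨ (p1OctTail b e).2.2 = 1) := by
  revert b e; decide

/-- The slot tables list cube corners (entries in `{0,1}`). -/
theorem p1OctHead_corner (b : Bool) (e : Fin 12) :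
    ((p1OctHead b e).1 = 0 ∨ (p1OctHead b e).1 = 1) ∧ ((p1OctHead b e).2.1 = 0 ∨ (p1OctHead b e).2.1 = 1) ∧
      ((p1OctHead b e).2.2 = 0 ∨ (p1OctHead b e).2.2 = 1) := by
  revert b e; decide

/-! ## Summability of the cube form -/

/-- **The cube form is dominated by the cube's total cell weight**: `p1CubeRec W n ≤ 192·B·Σ_π W(n,π)` with `B` the uniform bound of the
squared edge stretches (`W ≥ 0`). -/
theorem p1CubeRec_le_sum_weights {a h : ℝ} {U : ℤ × ℤ × ℤ → (Fin 3 → ℝ)} {b₀ : Fin 3 → ℝ} {A : Fin 3 → Fin 3 → ℝ} {K : ℝ≥0}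
    (hK : LipschitzWith K (p1Disp a h U b₀ A)) {W : (ℤ × ℤ × ℤ) × Fin 6 → ℝ} (hW : ∀ i, 0 ≤ W i) (n : ℤ × ℤ × ℤ) :
    p1CubeRec a h U b₀ A W n ≤ 192 * (3 * K * (2 * (2 * |a| + |h|)) ^ 2) ^ 2 * ∑ π : Fin 6, W (n, π) := by
  set B : ℝ := (3 * K * (2 * (2 * |a| + |h|)) ^ 2) ^ 2 with hBdef
  have hB0 : 0 ≤ B := by positivity
  have s0 : ∑ e : Fin 6, p1Str a h U b₀ A (n + p1TetTail (p1Par n) 0 e) (n + p1TetHead (p1Par n) 0 e) ^ 2 ≤ 6 * B := by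
    have := Finset.sum_le_sum fun (e : Fin 6) (_ : e ∈ Finset.univ) =>
      sq_p1Str_corner_le hK n _ _ (p1TetTail_corner (p1Par n) 0 e) (p1TetHead_corner (p1Par n) 0 e)
    simpa using this
  have s1 : ∑ e : Fin 6, p1Str a h U b₀ A (n + p1TetTail (p1Par n) 1 e) (n + p1TetHead (p1Par n) 1 e) ^ 2 ≤ 6 * B := by
    have := Finset.sum_le_sum fun (e : Fin 6) (_ : e ∈ Finset.univ) =>
      sq_p1Str_corner_le hK n _ _ (p1TetTail_corner (p1Par n) 1 e) (p1TetHead_corner (p1Par n) 1 e)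
    simpa using this
  have s2 : ∑ e : Fin 12, p1Str a h U b₀ A (n + p1OctTail (p1Par n) e) (n + p1OctHead (p1Par n) e) ^ 2 ≤ 12 * B := by
    have := Finset.sum_le_sum fun (e : Fin 12) (_ : e ∈ Finset.univ) =>
      sq_p1Str_corner_le hK n _ _ (p1OctTail_corner (p1Par n) e) (p1OctHead_corner (p1Par n) e)
    simpa using this
  have h0 := hW (n, 0)
  have h1 := hW (n, 1)
  have h2 := hW (n, 2)
  have h3 := hW (n, 3)
  have h4 := hW (n, 4)
  have h5 := hW (n, 5)
  have hm : p1OctW W n ≤ W (n, 2) + W (n, 3) + W (n, 4) + W (n, 5) := by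
    unfold p1OctW
    rcases le_total (max (W (n, 2)) (W (n, 3))) (max (W (n, 4)) (W (n, 5))) with hle | hle
    · rw [max_eq_right hle]
      rcases le_total (W (n, 4)) (W (n, 5)) with h' | h'
      · rw [max_eq_right h']; linarith
      · rw [max_eq_left h']; linarith
    · rw [max_eq_left hle]
      rcases le_total (W (n, 2)) (W (n, 3)) with h' | h'
      · rw [max_eq_right h']; linarith
      · rw [max_eq_left h']; linarith
  have hm0 : 0 ≤ p1OctW W n := by unfold p1OctW; exact le_max_of_le_left (le_max_of_le_left h2)
  rw [Fin.sum_univ_six]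
  unfold p1CubeRec
  have e0 := mul_le_mul_of_nonneg_left s0 (by positivity : 0 ≤ 4 * W (n, 0))
  have e1 := mul_le_mul_of_nonneg_left s1 (by positivity : 0 ≤ 4 * W (n, 1))
  have e2 := mul_le_mul_of_nonneg_left s2 (by positivity : 0 ≤ 16 * p1OctW W n)
  have e3 := mul_le_mul_of_nonneg_right hm hB0
  nlinarith [e0, e1, e2, e3, mul_nonneg h0 hB0, mul_nonneg h1 hB0, mul_nonneg h2 hB0, mul_nonneg h3 hB0,
    mul_nonneg h4 hB0, mul_nonneg h5 hB0]

/-- The cell weights of a nonnegative weight function are nonnegative. -/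
theorem p1CellWeight_nonneg {a h : ℝ} {w : (Fin 3 → ℝ) → ℝ} (hw0 : ∀ x, 0 ≤ w x) (i : (ℤ × ℤ × ℤ) × Fin 6) :
    0 ≤ ∫ x in p1RealCell a h i, w x :=
  setIntegral_nonneg (isClosed_p1RealCell a h i).measurableSet fun x _ => hw0 x

/-- **Cells decomposition as a `HasSum`**: `Σ_i ∫_{cell i} f = ∫ f` for integrable `f`. -/
theorem hasSum_setIntegral_p1RealCell {a h : ℝ} (ha : a ≠ 0) (hh : h ≠ 0) {f : (Fin 3 → ℝ) → ℝ} (hf : Integrable f) :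
    HasSum (fun i => ∫ x in p1RealCell a h i, f x) (∫ x, f x) := by
  have := hasSum_integral_iUnion_ae (μ := volume) (fun i => (isClosed_p1RealCell a h i).measurableSet.nullMeasurableSet)
    (p1RealCell_aedisjoint ha hh) (by rw [iUnion_p1RealCell]; exact hf.integrableOn)
  rwa [iUnion_p1RealCell, setIntegral_univ] at this

/-- The total cell weight of each cube, summed over cubes, is `∫ w`. -/
theorem hasSum_cube_weights {a h : ℝ} (ha : a ≠ 0) (hh : h ≠ 0) {w : (Fin 3 → ℝ) → ℝ} (hwi : Integrable w) :
    HasSum (fun n : ℤ × ℤ × ℤ => ∑ π : Fin 6, ∫ x in p1RealCell a h (n, π), w x) (∫ x, w x) :=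
  (hasSum_setIntegral_p1RealCell ha hh hwi).prod_fiberwise fun _ => hasSum_fintype _

/-- **Summability of the cube form** for the cell weights of an integrable nonnegative weight. -/
theorem summable_p1CubeRec {a h : ℝ} (ha : a ≠ 0) (hh : h ≠ 0) (U : ℤ × ℤ × ℤ → (Fin 3 → ℝ)) (hU : (support U).Finite)
    (b₀ : Fin 3 → ℝ) (A : Fin 3 → Fin 3 → ℝ) {w : (Fin 3 → ℝ) → ℝ} (hw0 : ∀ x, 0 ≤ w x) (hwi : Integrable w) :
    Summable (p1CubeRec a h U b₀ A fun i => ∫ x in p1RealCell a h i, w x) := by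
  obtain ⟨K, hK⟩ := exists_lipschitzWith_p1Disp ha hh U hU b₀ A
  have hW : ∀ i, 0 ≤ ∫ x in p1RealCell a h i, w x := p1CellWeight_nonneg hw0
  refine Summable.of_nonneg_of_le (fun n => p1CubeRec_nonneg a h U b₀ A hW n) (fun n => p1CubeRec_le_sum_weights hK hW n) ?_
  exact ((hasSum_cube_weights ha hh hwi).summable).mul_left _

/-! ## The receipts transfer -/

/-- **THE RECEIPTS TRANSFER**: on the hcp ratio box, for the far-ledger field `v = p1Disp a h U b₀ A` of a finitely supported
displacement and any nonnegative integrable weight `w` (with `w·fpRec(∇v)` integrable),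
`a⁴ · ∫ w(x)·fpRec(∇v(x)) dx ≤ Σ'_n p1CubeRec W n`, `W_i = ∫_{cell i} w` — the continuum receipts are dominated by a lattice quadratic
form in first-shell stretches with cube-local weights (sharp element constants 4 / 16).  NOT a proof of H12⋆, NOT summit progress. -/
theorem integral_fpRec_le_tsum_p1CubeRec {a h : ℝ} (ha : 0 < a) (hlo : 81619 / 100000 * a ≤ h) (hhi : h ≤ 81657 / 100000 * a)
    (U : ℤ × ℤ × ℤ → (Fin 3 → ℝ)) (hU : (support U).Finite) (b₀ : Fin 3 → ℝ) (A : Fin 3 → Fin 3 → ℝ) {w : (Fin 3 → ℝ) → ℝ}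
    (hw0 : ∀ x, 0 ≤ w x) (hwi : Integrable w) (hint : Integrable fun x => w x * fpRec (fpGrad (p1Disp a h U b₀ A) x)) :
    a ^ 4 * ∫ x, w x * fpRec (fpGrad (p1Disp a h U b₀ A) x) ≤
      ∑' n, p1CubeRec a h U b₀ A (fun i => ∫ x in p1RealCell a h i, w x) n := by
  have ha' : a ≠ 0 := ha.ne'
  have hh' : h ≠ 0 := by intro h0; rw [h0] at hlo; linarith
  have hW : ∀ i, 0 ≤ ∫ x in p1RealCell a h i, w x := p1CellWeight_nonneg hw0
  -- cell decomposition of the receipts integral, cube by cube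
  have hcells : HasSum (fun i => fpRec (p1CellGradT a h U A i) * ∫ x in p1RealCell a h i, w x)
      (∫ x, w x * fpRec (fpGrad (p1Disp a h U b₀ A) x)) := by
    refine (hasSum_setIntegral_p1RealCell ha' hh' hint).congr_fun fun i => ?_
    rw [setIntegral_p1RealCell_weight_fpGrad ha' hh' U b₀ A i w fpRec, fpRec_p1CellGradT]
  have hcubes : HasSum (fun n : ℤ × ℤ × ℤ => a ^ 4 * ∑ π : Fin 6, (∫ x in p1RealCell a h (n, π), w x) * fpRec (p1CellGradT a h U A (n, π)))
      (a ^ 4 * ∫ x, w x * fpRec (fpGrad (p1Disp a h U b₀ A) x)) := by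
    refine (hcells.prod_fiberwise fun n => ?_).mul_left (a ^ 4)
    simpa only [mul_comm] using hasSum_fintype (fun π : Fin 6 => (∫ x in p1RealCell a h (n, π), w x) * fpRec (p1CellGradT a h U A (n, π)))
  have hsum := summable_p1CubeRec ha' hh' U hU b₀ A hw0 hwi
  exact hasSum_le (fun n => p1Cube_receipts ha hlo hhi U b₀ A hW n) hcubes hsum.hasSum

/-! ## The form the assembly consumes: split weight centred at a site, re-based field -/

/-- Translation does not change Lipschitz constants. -/
theorem lipschitzWith_comp_add_left {v : (Fin 3 → ℝ) → (Fin 3 → ℝ)} {K : ℝ≥0} (hv : LipschitzWith K v) (y₀ : Fin 3 → ℝ) :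
    LipschitzWith K fun y => v (y₀ + y) := by
  have h1 : LipschitzWith 1 fun y : Fin 3 → ℝ => y₀ + y := LipschitzWith.of_edist_le fun x y => (edist_add_left y₀ x y).le
  have h2 := hv.comp h1
  rw [mul_one] at h2
  exact h2

/-- The gradient of the re-based field is the translated gradient. -/
theorem fpGrad_comp_add_left (v : (Fin 3 → ℝ) → (Fin 3 → ℝ)) (y₀ x : Fin 3 → ℝ) :
    fpGrad (fun y => v (y₀ + y)) x = fpGrad v (y₀ + x) := by
  funext i j
  simp only [fpGrad, fderiv_comp_add_left]

/-- **THE RECEIPTS TRANSFER AT A SITE** (the form the H12⋆ assembly consumes).  For a `C²` weight `χ` vanishing near `0` and `= 1`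
for `‖x‖ ≥ R` (e.g. the split weight `fpChi R₁² R₂²`), any base point `y₀` (the site `y_p`), and the re-based far-ledger field
`ṽ(x) = v(y₀ + x)` of `farPencil4_weighted_integral_le_p1Disp_translate`:
`a⁴ · ∫ χ(x)²·Den(x, ∇ṽ(x)) dx ≤ Σ'_n p1CubeRec W n` with `W_i = ∫_{cell i} χ(y − y₀)²·|y − y₀|⁻⁶ dy`, on the hcp ratio box, and the
cube form is summable.  NOT a proof of H12⋆, NOT summit progress. -/
theorem integral_chiSq_fpDen_translate_le_tsum {a h : ℝ} (ha : 0 < a) (hlo : 81619 / 100000 * a ≤ h) (hhi : h ≤ 81657 / 100000 * a)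
    (U : ℤ × ℤ × ℤ → (Fin 3 → ℝ)) (hU : (support U).Finite) (y₀ b₀ : Fin 3 → ℝ) (A : Fin 3 → Fin 3 → ℝ)
    {χ : (Fin 3 → ℝ) → ℝ} {R : ℝ} (hχ : ContDiff ℝ 2 χ) (hχ0 : (0 : Fin 3 → ℝ) ∉ tsupport χ)
    (hχ1 : ∀ y : Fin 3 → ℝ, R ≤ ‖y‖ → χ y = 1) :
    Summable (p1CubeRec a h U b₀ A fun i => ∫ y in p1RealCell a h i, χ (y - y₀) ^ 2 * (fpSq (y - y₀))⁻¹ ^ 3) ∧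
    a ^ 4 * ∫ x, χ x ^ 2 * fpDen x (fpGrad (fun y => p1Disp a h U b₀ A (y₀ + y)) x) ≤
      ∑' n, p1CubeRec a h U b₀ A (fun i => ∫ y in p1RealCell a h i, χ (y - y₀) ^ 2 * (fpSq (y - y₀))⁻¹ ^ 3) n := by
  have ha' : a ≠ 0 := ha.ne'
  have hh' : h ≠ 0 := by intro h0; rw [h0] at hlo; linarith
  -- the weight `w(y) = χ(y − y₀)²·|y − y₀|⁻⁶`
  set w : (Fin 3 → ℝ) → ℝ := fun y => χ (y - y₀) ^ 2 * (fpSq (y - y₀))⁻¹ ^ 3 with hw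
  have hw0 : ∀ y, 0 ≤ w y := fun y => mul_nonneg (sq_nonneg _) (pow_nonneg (inv_nonneg.2 (fpSq_nonneg _)) _)
  have hwi0 : Integrable fun x => χ x ^ 2 * (fpSq x)⁻¹ ^ 3 := by
    have := integrable_chiSq_mul_invPow hχ hχ0 hχ1 1 0
    simpa using this
  have hwi : Integrable w := hwi0.comp_sub_right y₀
  -- Lipschitz bounds for the re-based field and integrability of the receipts integrand
  obtain ⟨K, hK⟩ := exists_lipschitzWith_p1Disp ha' hh' U hU b₀ A
  have hKt := lipschitzWith_comp_add_left hK y₀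
  have hI : Integrable fun x => χ x ^ 2 * fpDen x (fpGrad (fun y => p1Disp a h U b₀ A (y₀ + y)) x) := by
    refine (integrable_chiSq_mul_invPow hχ hχ0 hχ1 (108 / 5 * (K : ℝ) ^ 2) 0).mono'
      (measurable_chiSq_mul_fpDen (v := fun y => p1Disp a h U b₀ A (y₀ + y)) hχ.continuous).aestronglyMeasurable
      (ae_of_all _ fun x => ?_)
    rw [Real.norm_eq_abs, abs_mul, abs_of_nonneg (sq_nonneg _), zero_mul, add_zero]
    exact mul_le_mul_of_nonneg_left (abs_fpDen_le (abs_fpGrad_le_of_lipschitz hKt x)) (sq_nonneg _)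
  -- change of variables `x = y − y₀`
  have hcov : ∫ x, χ x ^ 2 * fpDen x (fpGrad (fun y => p1Disp a h U b₀ A (y₀ + y)) x) =
      ∫ y, w y * fpRec (fpGrad (p1Disp a h U b₀ A) y) := by
    have e1 : (fun x => χ x ^ 2 * fpDen x (fpGrad (fun y => p1Disp a h U b₀ A (y₀ + y)) x)) =
        fun x => (fun y => w y * fpRec (fpGrad (p1Disp a h U b₀ A) y)) (y₀ + x) := by
      funext x
      simp only [hw, fpDen, fpGrad_comp_add_left, add_sub_cancel_left]
      ring
    rw [e1]
    exact integral_add_left_eq_self (fun y => w y * fpRec (fpGrad (p1Disp a h U b₀ A) y)) y₀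
  have hint : Integrable fun y => w y * fpRec (fpGrad (p1Disp a h U b₀ A) y) := by
    have e2 : (fun y => w y * fpRec (fpGrad (p1Disp a h U b₀ A) y)) =
        fun y => (fun x => χ x ^ 2 * fpDen x (fpGrad (fun y => p1Disp a h U b₀ A (y₀ + y)) x)) (y - y₀) := by
      funext y
      simp only [hw, fpDen, fpGrad_comp_add_left, add_sub_cancel]
      ring
    rw [e2]
    exact hI.comp_sub_right y₀
  refine ⟨summable_p1CubeRec ha' hh' U hU b₀ A hw0 hwi, ?_⟩
  rw [hcov]
  exact integral_fpRec_le_tsum_p1CubeRec ha hlo hhi U hU b₀ A hw0 hwi hint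

end Summit.AtomisticToContinuum.Crystallization.Theorems.StrictSplittingRuleBirth
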